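import Summits.RiemannHypothesis.RiemannHypothesis.Theorems.PfPersistencePowerMap
import Summits.RiemannHypothesis.RiemannHypothesis.Theorems.PfPersistenceFlooredTubes
import HarnessLib

/-!
# PF persistence — ⊗-POWER-STABLE READERS: tower locality and the neighbourhood theorem
(pub-rhpf barrier-typer gen 13, part 2 of 2; verdict V23 on candidate class C2-N10, GAP-CLASSES l.1989,
'⊗-POWER-STABLE PAIR ∩ 𝓔'; part 1 = `PfPersistencePowerMap`: `powerWeights m = ψ_m`, `eulerDial`, recovery)

**HONEST FRAMING. This is a long-odds MECHANISM SEARCH; no RH claims.** Every statement below is RH-free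
bookkeeping about weight tables and windowed even blocks; nothing decides any Weil positivity. Labels:
PROVED = kernel-checked here; TYPED = a definition; DATA = the cell's numerics (never used below).

## The candidate (cand-2, C2-N10)

`𝒞_⊗(M) := {d ∈ 𝓔 : d is a pair-reader member AND every formal tensor power d^{⊗m} (c_p ↦ c_p^m,
m = 2..M; ζ ↦ ζ) passes the parity grounds at every SERVED core window}` — a served-window (finitely
determined) class intersected with "all tensor powers up to order `M` also pass".

## What is proved

* §4 ⊗-TOWER LOCALITY (leaf W1 transported, RH-free): every criterion determined by finitely many windows
  that accepts `ζ` accepts, for some prime `p` beyond every window it reads and some `K > 1`, the WHOLE TOWER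
  `ψ_m(eulerDial p K) = eulerDial p K^m`, `m ≥ 0`, of an `𝓔`-member `≠ ζ` — every level `m ≥ 1` negative on
  the first basis vector at EVERY genuine window of half-length `log p`, every rank `N` (threshold form of the
  far-prime witness: ALL amplifications `K ≥ K₀` are negative, so all powers `K^m ≥ K` are; the `(0,0)` entry
  does not see `N`). Hence the ⊗-stable core `powerStableCore M S` of EVERY order `M` meets the accepted,
  detectably negative, non-`ζ` Euler data (`powerStableCore_meets_negativesNe`), and no finitely determined
  criterion separates `ζ` on a domain containing them (`not_separates_powerStable`): "all powers also pass"
  removes NO far negative; inside the served windows the class is DATA. PROVED.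
* §5 FINITE-ORDER ⊗-STABILITY IS A NEIGHBOURHOOD CONDITION: `ψ_m` maps the relative `t`-ball at `ζ` (below
  any cutoff) into the relative `((1+t)^m − 1)`-ball (`RelClose.powerWeights`); hence a reader accepting a
  relative `r`-ball accepts `ψ_0 … ψ_M` of every arithmetic table in a relative `t(r, M)`-ball, `t > 0`
  (`exists_relBall_subset_powerStableCore`). PROVED.
* §6 EVERY MARGIN READER ACCEPTS A RELATIVE BALL: a criterion holding at `ζ` with an entrywise margin on
  finitely many windows (`FinitelyRobustAt S zetaDatum`) accepts a relative `r`-ball below its largest reach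
  (`FinitelyRobustAt.exists_acceptsRelBall`, modulus `|Q^w_{ij} − Q^ζ_{ij}| ≤ 4t Σ_{q ≤ e^{2a}} ζ(q)` from
  `|θ^ev| ≤ 2`), hence has a whole relative ball of the chart around `ζ` inside its order-`M` ⊗-stable core for
  EVERY finite `M` (`FinitelyRobustAt.exists_relBall_subset_powerStableCore`). So at finite order the class is
  never empty near `ζ`, and the order at which a far candidate leaves it measures that candidate's distance
  from `ζ` against `t(r, M) → 0`, not an invariant of the candidate. PROVED.

DOOR (words only, no kernel content): the non-perturbative tensor-power mechanism (even tensor powers with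
Rankin's trick in Deligne's Weil I; Rankin–Selberg positivity — references in the cell's MEMBERSHIP.md, verdict
V23) needs every `ψ_m d` to be the table of a GENUINE L-function (rationality / functional equation /
automorphy) — a property invisible window by window; inside the chart `ψ_m` is a polynomial self-map carrying
no such constraint (doors E2 + FF of the cell's ESCAPE-DOORS.md).
-/

set_option linter.dupNamespace false  -- the mandated namespace repeats `RiemannHypothesis`

noncomputable section

open Real Finset Matrix

namespace Summit.RiemannHypothesis.RiemannHypothesis.Theorems.PfPersistence


/-! ## §4 ⊗-TOWER LOCALITY (RH-free): every finitely determined reader accepts whole towers of negatives -/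

/-- PROVED (explicit threshold — ALL large amplifications, EVERY rank): for a half-length `a` reaching `p`
(`log p < 2a`) and `w(p) > 0`, some `K₀ > 1` makes the first basis vector's Rayleigh value of the dialled block
NEGATIVE FOR EVERY `K ≥ K₀` AT EVERY WINDOW `(a, N)`, `N ≥ 0` (the `(0,0)` entry is affine decreasing in `K`,
`evenBlock_dial_zero_zero`, and does not depend on `N`). [this work] -/
theorem exists_threshold_dial_negative {p : ℕ} {a : ℝ} (ha : 0 < a) (hp : Real.log p < 2 * a)
    {w : Weights} (hw : 0 < w p) :
    ∃ K₀ : ℝ, 1 < K₀ ∧ ∀ win : Window, win.a = a → ∀ K : ℝ, K₀ ≤ K →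
      (Pi.single 0 1 : Fin (win.N + 1) → ℝ) ⬝ᵥ (evenBlock (dial p K w) win *ᵥ Pi.single 0 1) < 0 := by
  obtain ⟨s, hs⟩ : ∃ s : ℝ, s = (2 * a - Real.log p) / (2 * a) := ⟨_, rfl⟩
  obtain ⟨c, hc⟩ : ∃ c : ℝ, c = weil (2 * a) w (thetaEven (2 * a) 0 0) := ⟨_, rfl⟩
  have hspos : 0 < s := by rw [hs]; exact div_pos (by linarith) (by linarith)
  have ht : 0 < 2 * w p * s := by positivity
  refine ⟨1 + (|c| + 1) / (2 * w p * s), ?_, fun win hwin K hK => ?_⟩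
  · have : 0 < (|c| + 1) / (2 * w p * s) := div_pos (by positivity) ht
    linarith
  have hmem : p ∈ primeRange (2 * win.a) := mem_primeRange_of_log_le (by rw [hwin]; exact hp.le)
  have hcw : evenBlock w win 0 0 = c := by rw [hc]; simp only [evenBlock, Fin.val_zero, hwin]
  rw [single_zero_rayleigh, evenBlock_dial_zero_zero hmem, hcw, hwin, ← hs]
  have h1 : |c| + 1 ≤ (K - 1) * (2 * w p * s) := (div_le_iff₀ ht).1 (by linarith)
  have h2 : 2 * (K - 1) * w p * s = (K - 1) * (2 * w p * s) := by ring
  rw [h2]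
  linarith [le_abs_self c]

/-- PROVED (core of the far-prime witnesses, threshold form): for every finite window set `W` there are a prime
`p` beyond the reach of every window of `W` and a threshold `K₀ > 1` such that EVERY dial `K ≥ K₀` of `ζ` at `p`
is negative on the first basis vector at EVERY genuine window of half-length `log p` (every rank `N`). [this work] -/
theorem exists_prime_beyond_threshold (W : Finset Window) :
    ∃ (p : ℕ) (_ : p.Prime) (K₀ : ℝ), 1 < K₀ ∧ (∀ win ∈ W, Real.exp (2 * win.a) < p) ∧
      ∀ win : Window, win.a = Real.log p → ∀ K : ℝ, K₀ ≤ K →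
        (Pi.single 0 1 : Fin (win.N + 1) → ℝ) ⬝ᵥ (evenBlock (dial p K zetaWeights) win *ᵥ Pi.single 0 1) < 0 := by
  let B : ℕ := (W.image fun win => ⌈Real.exp (2 * win.a)⌉₊).sup id + 1
  have hB : ∀ win ∈ W, Real.exp (2 * win.a) < B := by
    intro win hwin
    have h1 : Real.exp (2 * win.a) ≤ (⌈Real.exp (2 * win.a)⌉₊ : ℝ) := Nat.le_ceil _
    have h2 : ⌈Real.exp (2 * win.a)⌉₊ ≤ (W.image fun win => ⌈Real.exp (2 * win.a)⌉₊).sup id :=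
      Finset.le_sup (f := id) (Finset.mem_image_of_mem _ hwin)
    have h2' : (⌈Real.exp (2 * win.a)⌉₊ : ℝ) ≤ ((W.image fun win => ⌈Real.exp (2 * win.a)⌉₊).sup id : ℕ) := by
      exact_mod_cast h2
    have h3 : (B : ℝ) = ((W.image fun win => ⌈Real.exp (2 * win.a)⌉₊).sup id : ℕ) + 1 := by
      simp only [B]; push_cast; ring
    linarith
  obtain ⟨p, hpB, hp⟩ := Nat.exists_infinite_primes (max B 2)
  have hpB' : (B : ℝ) ≤ p := by exact_mod_cast (le_max_left B 2).trans hpB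
  have hp2 : (2 : ℝ) ≤ p := by exact_mod_cast (le_max_right B 2).trans hpB
  have hlogp : 0 < Real.log p := Real.log_pos (by linarith)
  obtain ⟨K₀, hK₀, hneg⟩ :=
    exists_threshold_dial_negative (p := p) (a := Real.log p) hlogp (by linarith) (zetaWeights_pos_of_prime hp)
  exact ⟨p, hp, K₀, hK₀, fun win hwin => (hB win hwin).trans_le hpB', hneg⟩

/-- PROVED: at every window of half-length `log p` (reach `e^{2a} = p²`, endpoint invisible) the Euler dial and
the bare dial have the SAME block, whatever the rank `N`. [this work] -/
theorem evenBlock_eulerDial_of_a_eq {p : ℕ} (hp : p.Prime) (K : ℝ) {win : Window}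
    (hwin : win.a = Real.log p) : evenBlock (eulerDial p K) win = evenBlock (dial p K zetaWeights) win := by
  have h : Real.exp (2 * win.a) = (p : ℝ) ^ 2 := by
    rw [hwin, ← logWindow_a p hp.two_le, exp_two_mul_logWindow_a hp]
  exact evenBlock_eq_of_eq_below _ h.le fun q hq => eulerDial_eq_dial_below hp K (by exact_mod_cast hq)

/-- **PROVED — ⊗-TOWER LOCALITY, bare dials (RH-free).** A criterion determined by finitely many windows that
accepts `ζ` accepts, for some prime `p` and `K > 1`, EVERY tensor power `ψ_m (dial p K ζ) = dial p K^m ζ`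
(`m ≥ 0`), and every level `m ≥ 1` is negative at every genuine window of half-length `log p`. [this work] -/
theorem exists_dialTower_mem_negative {S : Set Datum} (hS : FinitelyDetermined S) (hζ : zetaDatum ∈ S) :
    ∃ (p : ℕ) (_ : p.Prime) (K : ℝ), 1 < K ∧
      (∀ m : ℕ, datumOf (powerWeights m (dial p K zetaWeights)) ∈ S) ∧
      ∀ m : ℕ, 1 ≤ m → ∀ win : Window, win.a = Real.log p → ∃ v : Fin (win.N + 1) → ℝ,
        v ⬝ᵥ (datumOf (powerWeights m (dial p K zetaWeights)) win *ᵥ v) < 0 := by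
  obtain ⟨W, hW⟩ := hS
  obtain ⟨p, hp, K₀, hK₀, hfar, hneg⟩ := exists_prime_beyond_threshold W
  refine ⟨p, hp, K₀, hK₀, fun m => ?_, fun m hm win hwin => ⟨Pi.single 0 1, ?_⟩⟩
  · rw [powerWeights_dial_zeta]
    refine (hW zetaDatum _ fun win hwin => ?_).1 hζ
    show evenBlock zetaWeights win = evenBlock (dial p (K₀ ^ m) zetaWeights) win
    rw [evenBlock_dial_of_not_mem (hfar win hwin)]
  · rw [powerWeights_dial_zeta]
    exact hneg win hwin _ (le_self_pow₀ hK₀.le (by omega))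

/-- **PROVED — ⊗-TOWER LOCALITY on the Euler chart `𝓔` (RH-free; the C2-N10 reading).** Same, with the
Euler-consistent dial: the reader accepts the whole tower `ψ_m (eulerDial p K) = eulerDial p K^m`, `m ≥ 0`, of
an `𝓔`-member, every level `m ≥ 1` negative at every genuine window of half-length `log p`, every rank `N`
(there the Euler dial's block IS the bare dial's, `evenBlock_eulerDial_of_a_eq`; on the reader's windows it
IS `ζ`'s, `evenBlock_eulerDial_of_le`). [this work] -/
theorem exists_eulerTower_mem_negative {S : Set Datum} (hS : FinitelyDetermined S) (hζ : zetaDatum ∈ S) :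
    ∃ (p : ℕ) (_ : p.Prime) (K : ℝ), 1 < K ∧
      (∀ m : ℕ, datumOf (powerWeights m (eulerDial p K)) ∈ S) ∧
      ∀ m : ℕ, 1 ≤ m → ∀ win : Window, win.a = Real.log p → ∃ v : Fin (win.N + 1) → ℝ,
        v ⬝ᵥ (datumOf (powerWeights m (eulerDial p K)) win *ᵥ v) < 0 := by
  obtain ⟨W, hW⟩ := hS
  obtain ⟨p, hp, K₀, hK₀, hfar, hneg⟩ := exists_prime_beyond_threshold W
  refine ⟨p, hp, K₀, hK₀, fun m => ?_, fun m hm win hwin => ⟨Pi.single 0 1, ?_⟩⟩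
  · rw [powerWeights_eulerDial]
    refine (hW zetaDatum _ fun win hwin => ?_).1 hζ
    show evenBlock zetaWeights win = evenBlock (eulerDial p (K₀ ^ m)) win
    rw [evenBlock_eulerDial_of_le hp _ (hfar win hwin).le]
  · rw [powerWeights_eulerDial]
    show (Pi.single 0 1) ⬝ᵥ (evenBlock (eulerDial p (K₀ ^ m)) win *ᵥ Pi.single 0 1) < 0
    rw [evenBlock_eulerDial_of_a_eq hp _ hwin]
    exact hneg win hwin _ (le_self_pow₀ hK₀.le (by omega))

/-- **PROVED — the C2-N10 verdict, kernel form (leaf W1 for ⊗-stable classes of EVERY order; RH-free).** The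
⊗-stable core of every finitely determined criterion accepting `ζ` contains an Euler table `≠ ζ` whose datum is
accepted and detectably negative — together with ALL its tensor powers, each negative at every window of
half-length `log p` (every rank `N`, in particular at `logWindow p`). "All powers also pass" removes no far
negative. [this work] -/
theorem powerStableCore_meets_negativesNe {S : Set Datum} (hS : FinitelyDetermined S) (hζ : zetaDatum ∈ S)
    (M : ℕ) : ∃ w ∈ powerStableCore M S, datumOf w ∈ S ∧ datumOf w ≠ zetaDatum ∧
      DetectablyNegative (datumOf w) ∧ ∀ m, 1 ≤ m → DetectablyNegative (datumOf (powerWeights m w)) := by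
  obtain ⟨p, hp, K, hK, hmem, hneg⟩ := exists_eulerTower_mem_negative hS hζ
  have h1 : powerWeights 1 (eulerDial p K) = eulerDial p K := powerWeights_one (eulerDial_mem_arithWeights p K)
  have hneg' : ∀ m, 1 ≤ m → DetectablyNegative (datumOf (powerWeights m (eulerDial p K))) := fun m hm =>
    ⟨logWindow p hp.two_le, hneg m hm (logWindow p hp.two_le) (logWindow_a p hp.two_le)⟩
  refine ⟨eulerDial p K, ⟨eulerDial_mem_arithWeights p K, fun m _ => hmem m⟩, by simpa [h1] using hmem 1,
    ?_, by simpa [h1] using hneg' 1 le_rfl, hneg'⟩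
  rw [Ne, datumOf_eq_zetaDatum_iff (arithWeights_subset_originFreeWeights (eulerDial_mem_arithWeights p K))]
  exact eulerDial_ne_zetaWeights hp hK.ne'

/-- PROVED (set form): no finitely determined criterion SEPARATES `ζ` from the detectably negative data of its
own ⊗-stable core, at any order `M` — so none separates `ζ` on any domain containing those data. [this work] -/
theorem not_separates_powerStable {S D : Set Datum} (M : ℕ) (hD : datumOf '' powerStableCore M S ⊆ D)
    (hS : FinitelyDetermined S) : ¬ Separates S D zetaDatum := by
  rintro ⟨hζ, hsep⟩
  obtain ⟨w, hw, hwS, -, hneg, -⟩ := powerStableCore_meets_negativesNe hS hζ M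
  exact hsep _ (hD ⟨w, hw, rfl⟩) hneg hwS

/-! ## §5 Finite-order ⊗-stability is a neighbourhood condition at `ζ` -/

/-- PROVED (the elementary estimate): `0 ≤ t ≤ 1`, `|x − 1| ≤ t` ⇒ `|x^m − 1| ≤ (1+t)^m − 1`
(upper side monotonicity; lower side Bernoulli twice: `(1+t)^m + (1−t)^m ≥ 2`). [folklore] -/
theorem abs_pow_sub_one_le {x t : ℝ} (ht0 : 0 ≤ t) (ht1 : t ≤ 1) (hx : |x - 1| ≤ t) (m : ℕ) :
    |x ^ m - 1| ≤ (1 + t) ^ m - 1 := by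
  obtain ⟨h1, h2⟩ := abs_sub_le_iff.1 hx
  have hx0 : 0 ≤ x := by linarith
  have hup : x ^ m ≤ (1 + t) ^ m := pow_le_pow_left₀ hx0 (by linarith) m
  have hlow : (1 - t) ^ m ≤ x ^ m := pow_le_pow_left₀ (by linarith) (by linarith) m
  have hb1 : 1 + (m : ℝ) * t ≤ (1 + t) ^ m := one_add_mul_le_pow (by linarith) m
  have hb2 : 1 + (m : ℝ) * (-t) ≤ (1 + (-t)) ^ m := one_add_mul_le_pow (by linarith) m
  rw [← sub_eq_add_neg, mul_neg] at hb2
  rw [abs_sub_le_iff]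
  constructor <;> linarith

/-- **PROVED — `ψ_m` IS RELATIVELY LIPSCHITZ AT `ζ`.** `ψ_m` maps the relative `t`-ball below `B`
(`0 ≤ t ≤ 1`) into the relative `((1+t)^m − 1)`-ball below `B`. [this work] -/
theorem RelClose.powerWeights {t : ℝ} {B : ℕ} {w : Weights} (h : RelClose t B w) (ht0 : 0 ≤ t)
    (ht1 : t ≤ 1) (m : ℕ) : RelClose ((1 + t) ^ m - 1) B (powerWeights m w) := by
  intro q hq
  rcases (zetaWeights_nonneg q).eq_or_lt with hz | hz
  · simp [PfPersistence.powerWeights, ← hz]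
  · have hx : |w q / zetaWeights q - 1| ≤ t := by
      rw [div_sub_one hz.ne', abs_div, abs_of_pos hz, div_le_iff₀ hz]
      exact h q hq
    have key := abs_pow_sub_one_le ht0 ht1 hx m
    have : PfPersistence.powerWeights m w q - zetaWeights q
        = zetaWeights q * ((w q / zetaWeights q) ^ m - 1) := by
      simp only [PfPersistence.powerWeights]; ring
    rw [this, abs_mul, abs_of_pos hz, mul_comm]
    exact mul_le_mul_of_nonneg_right key hz.le

/-- PROVED: for `r > 0` and an order `M`, some `0 < t ≤ 1` has `(1+t)^M − 1 ≤ r` (continuity at `t = 0`). [folklore] -/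
theorem exists_pos_pow_sub_one_le {r : ℝ} (hr : 0 < r) (M : ℕ) :
    ∃ t : ℝ, 0 < t ∧ t ≤ 1 ∧ (1 + t) ^ M - 1 ≤ r := by
  have hc : Continuous fun t : ℝ => (1 + t) ^ M - 1 := by continuity
  have h0 : (fun t : ℝ => (1 + t) ^ M - 1) 0 < (fun _ : ℝ => r) 0 := by simp [hr]
  have hev := hc.continuousAt.eventually_lt continuousAt_const h0
  obtain ⟨δ, hδ, hball⟩ := Metric.eventually_nhds_iff.1 hev
  refine ⟨min 1 (δ / 2), by positivity, min_le_left _ _, le_of_lt (hball ?_)⟩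
  rw [Real.dist_eq, sub_zero, abs_of_pos (by positivity)]
  exact (min_le_right _ _).trans_lt (by linarith)

/-- **PROVED — FINITE-ORDER ⊗-STABILITY IS A NEIGHBOURHOOD CONDITION.** A reader accepting a relative `r`-ball
(`r > 0`) has, for every order `M`, a radius `t = t(r, M) > 0` such that EVERY arithmetic table relatively
`t`-close to `ζ` below `B` lies in the order-`M` ⊗-stable core: `𝒞_⊗(M) ⊇` a neighbourhood of `ζ` in the chart.
Failure of ⊗-stability at order `M` along a ray therefore measures the ray's distance from `ζ`. [this work] -/
theorem exists_relBall_subset_powerStableCore {S : Set Datum} {r : ℝ} {B : ℕ} (hS : AcceptsRelBall S r B)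
    (hr : 0 < r) (M : ℕ) :
    ∃ t : ℝ, 0 < t ∧ ∀ w ∈ arithWeights, RelClose t B w → w ∈ powerStableCore M S := by
  obtain ⟨t, ht0, ht1, htM⟩ := exists_pos_pow_sub_one_le hr M
  refine ⟨t, ht0, fun w hw hclose => ⟨hw, fun m hm => hS _ (powerWeights_mem_arithWeights m w) ?_⟩⟩
  refine (hclose.powerWeights ht0.le ht1 m).mono (le_trans ?_ htM)
  have : (1 + t) ^ m ≤ (1 + t) ^ M := pow_le_pow_right₀ (by linarith) hm
  linarith

/-! ## §6 Margin readers accept a relative ball at `ζ` (so §5 applies to every `FinitelyRobustAt` reader) -/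

/-- PROVED: a position in reach of half-length `L ≥ 0` has its logarithm in `[0, L]`. [folklore] -/
theorem log_mem_of_mem_primeRange {L : ℝ} {q : ℕ} (hq : q ∈ primeRange L) (hL : 0 ≤ L) :
    0 ≤ Real.log q ∧ Real.log q ≤ L := by
  refine ⟨Real.log_natCast_nonneg q, ?_⟩
  have hq' : (q : ℝ) ≤ Real.exp L := by
    have h1 : q ≤ ⌊Real.exp L⌋₊ := Nat.lt_succ_iff.1 (Finset.mem_range.1 hq)
    exact (Nat.cast_le.2 h1).trans (Nat.floor_le (Real.exp_pos L).le)
  rcases Nat.eq_zero_or_pos q with rfl | hpos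
  · simpa using hL
  · exact (Real.log_le_iff_le_exp (by exact_mod_cast hpos)).2 hq'

/-- PROVED (entrywise modulus of continuity at `ζ`): a table relatively `t`-close to `ζ` up to the reach of a
window has every block entry within `4 t Σ_{q ≤ e^{2a}} ζ(q)` of `ζ`'s (`|θ^ev| ≤ 2` on `[0, 2a]`,
`abs_thetaEven_le_two`; difference formula `evenBlock_sub_apply`). [this work] -/
theorem abs_evenBlock_sub_zeta_le {t : ℝ} {B : ℕ} {w : Weights} (hw : RelClose t B w) (win : Window)
    (hB : ⌊Real.exp (2 * win.a)⌋₊ ≤ B) (i j : Fin (win.N + 1)) :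
    |evenBlock w win i j - zetaDatum win i j| ≤ 4 * t * ∑ q ∈ primeRange (2 * win.a), zetaWeights q := by
  have ha : 0 < 2 * win.a := by linarith [win.ha]
  have key : ∀ q ∈ primeRange (2 * win.a),
      |(w q - zetaWeights q) * thetaEven (2 * win.a) i j (Real.log q)| ≤ 2 * t * zetaWeights q := by
    intro q hq
    have hqB : q ≤ B := (Nat.lt_succ_iff.1 (Finset.mem_range.1 hq)).trans hB
    obtain ⟨h0, hL⟩ := log_mem_of_mem_primeRange hq ha.le
    have h1 := hw q hqB
    have h2 := abs_thetaEven_le_two ha h0 hL (i : ℕ) (j : ℕ)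
    rw [abs_mul]
    calc |w q - zetaWeights q| * |thetaEven (2 * win.a) i j (Real.log q)| ≤ t * zetaWeights q * 2 :=
          mul_le_mul h1 h2 (abs_nonneg _) ((abs_nonneg _).trans h1)
      _ = 2 * t * zetaWeights q := by ring
  calc |evenBlock w win i j - zetaDatum win i j|
      = 2 * |∑ q ∈ primeRange (2 * win.a), (w q - zetaWeights q) * thetaEven (2 * win.a) i j (Real.log q)| := by
        rw [show zetaDatum win i j = evenBlock zetaWeights win i j from rfl, evenBlock_sub_apply, abs_neg, abs_mul,
          abs_two]
    _ ≤ 2 * ∑ q ∈ primeRange (2 * win.a), |(w q - zetaWeights q) * thetaEven (2 * win.a) i j (Real.log q)| := by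
        gcongr; exact Finset.abs_sum_le_sum_abs _ _
    _ ≤ 2 * ∑ q ∈ primeRange (2 * win.a), 2 * t * zetaWeights q := by
        gcongr with q hq; exact key q hq
    _ = 4 * t * ∑ q ∈ primeRange (2 * win.a), zetaWeights q := by
        rw [Finset.mul_sum, Finset.mul_sum]; exact Finset.sum_congr rfl fun q _ => by ring

/-- **PROVED — every finitely robust reader accepts a relative ball at `ζ` (RH-free).** A criterion holding at
`ζ` with an entrywise margin `ε` on finitely many windows `W` accepts every arithmetic table relatively
`ε / (4Z + 4)`-close to `ζ` below the largest reach of `W` (`Z = Σ_{win ∈ W} Σ_{q ≤ e^{2a}} ζ(q)`). [this work] -/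
theorem FinitelyRobustAt.exists_acceptsRelBall {S : Set Datum} (h : FinitelyRobustAt S zetaDatum) :
    ∃ r : ℝ, 0 < r ∧ ∃ B : ℕ, AcceptsRelBall S r B := by
  obtain ⟨W, ε, hε, hS⟩ := h
  let B : ℕ := W.sup fun win => ⌊Real.exp (2 * win.a)⌋₊
  let Z : ℝ := ∑ win ∈ W, ∑ q ∈ primeRange (2 * win.a), zetaWeights q
  have hZ : 0 ≤ Z := Finset.sum_nonneg fun win _ => Finset.sum_nonneg fun q _ => zetaWeights_nonneg q
  have h4 : 0 < 4 * Z + 4 := by linarith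
  refine ⟨ε / (4 * Z + 4), div_pos hε h4, B, fun w _ hw => hS _ fun win hwin i j => ?_⟩
  have hB : ⌊Real.exp (2 * win.a)⌋₊ ≤ B := Finset.le_sup (f := fun win : Window => ⌊Real.exp (2 * win.a)⌋₊) hwin
  have hZw : ∑ q ∈ primeRange (2 * win.a), zetaWeights q ≤ Z :=
    Finset.single_le_sum (f := fun win : Window => ∑ q ∈ primeRange (2 * win.a), zetaWeights q)
      (fun win _ => Finset.sum_nonneg fun q _ => zetaWeights_nonneg q) hwin
  have hr0 : 0 ≤ 4 * (ε / (4 * Z + 4)) := by positivity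
  calc |datumOf w win i j - zetaDatum win i j|
      ≤ 4 * (ε / (4 * Z + 4)) * ∑ q ∈ primeRange (2 * win.a), zetaWeights q := abs_evenBlock_sub_zeta_le hw win hB i j
    _ ≤ 4 * (ε / (4 * Z + 4)) * Z := by gcongr
    _ < ε := by
        rw [show 4 * (ε / (4 * Z + 4)) * Z = ε * (4 * Z) / (4 * Z + 4) by ring, div_lt_iff₀ h4]
        exact mul_lt_mul_of_pos_left (by linarith) hε

/-- **PROVED — the C2-N10 NEIGHBOURHOOD VERDICT for margin readers (RH-free).** A reader holding at `ζ` with a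
margin on finitely many windows (every served-window P2-type reader with slack) has, at EVERY finite order `M`,
a whole relative ball of the arithmetic chart around `ζ` inside its order-`M` ⊗-stable core: finite-order
⊗-stability is an OPEN condition at `ζ`, never empty near `ζ`; what a far candidate's exit order measures is its
distance from `ζ`. [this work] -/
theorem FinitelyRobustAt.exists_relBall_subset_powerStableCore {S : Set Datum}
    (h : FinitelyRobustAt S zetaDatum) (M : ℕ) :
    ∃ (B : ℕ) (t : ℝ), 0 < t ∧ ∀ w ∈ arithWeights, RelClose t B w → w ∈ powerStableCore M S := by
  obtain ⟨r, hr, B, hS⟩ := h.exists_acceptsRelBall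
  obtain ⟨t, ht, hcore⟩ := PfPersistence.exists_relBall_subset_powerStableCore hS hr M
  exact ⟨B, t, ht, hcore⟩

end Summit.RiemannHypothesis.RiemannHypothesis.Theorems.PfPersistence
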